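import Literature.Computability.Complexity.HypercontractivityTwoQ
import HarnessLib

/-!
# `(p, q)`-hypercontractivity on the uniform cube for `p ≤ 2 ≤ q`, and the tail of `T_ρ f` for a flat density (Bonami–Beckner; Fawzi 2021, Lemma 1)

Infrastructure in the conventions of `HypercontractivityTwoQ.lean` (real functions
`g : (Fin m → Bool) → ℝ` on the uniform cube, the noise operator `noiseOperator ρ g`, uniform
averages written `(∑ x, …) / 2 ^ m`).

* `noiseOperator_hypercontractive` — **the Bonami–Beckner hypercontractivity theorem in the range
  `1 < p ≤ 2 ≤ q`**: `(E|T_ρ g|^q)^{1/q} ≤ (E|g|^p)^{1/p}` whenever `0 ≤ ρ` and `ρ² ≤ (p-1)/(q-1)`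
  (O'Donnell 2014, Ch. 9, "Hypercontractivity Theorem": "`‖T_ρ f‖_q ≤ ‖f‖_p` for
  `0 ≤ ρ ≤ √((p-1)/(q-1))`"; Fawzi 2021, Thm. 3: "`‖T_ρ f‖_q ≤ ‖f‖_p` where `q = 1 + ρ^{-2}(p-1)`").
  PROOF (a genuinely shorter road than the printed two-point induction, recorded as such): the tree
  already has the two one-sided halves — `(p,2)` (`avg_sq_noiseOperator_le`, O'Donnell §9.4) and
  `(2,q)` (`noiseOperator_hypercontractive_two_q`) — and the semigroup law
  `T_ρ = T_{ρ/√(p-1)} ∘ T_{√(p-1)}` (`noiseOperator_noiseOperator`) chains them: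
  `‖T_ρ g‖_q ≤ ‖T_{√(p-1)} g‖₂ ≤ ‖g‖_p`, the first step needing exactly `ρ²/(p-1) ≤ 1/(q-1)`.
  The complementary ranges `p ≤ q ≤ 2` and `2 ≤ p ≤ q` are NOT treated here.
* `noiseOperator_nonneg`, `sum_noiseOperator` — positivity (`0 ≤ ρ ≤ 1`) and mean preservation of `T_ρ`.
* `card_noiseOperator_ge_le` — **Fawzi 2021, Lemma 1** in counting form and with the parameters kept
  symbolic: for `f ≥ 0` with `E f = 1` and `max f ≤ M`, `log M ≥ 1`, and `p = 1 + 1/log M`,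
  `q = 1 + (p-1)/ρ² ≥ 2`, every threshold `t > 0` has `#{y : T_ρ f(y) ≥ t} ≤ 2^m · (e/t)^q`
  (printed: "`μ{x : T_ρ f(x) ≥ t} ≤ ‖f‖_p^q / t^q`, `‖f‖_p ≤ M^{(p-1)/p} ≤ M^{p-1}`, `p = 1 + 1/log M`
  … `M^{p-1} = exp(1)`"; with `M = e^{√n}`, `ρ = √(5/n)` this is the printed `(e/t)^{1 + n/(5 log M)}`).

Everything is a finite sum and is proved; no definitions, no named facts.

## References

* R. O'Donnell, *Analysis of Boolean Functions*, Cambridge University Press, 2014, Ch. 9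
  (Hypercontractivity Theorem; §9.4 two-function form) [ODonnell2014].
* H. Fawzi, *On polyhedral approximations of the positive semidefinite cone*, Math. Oper. Res. 46
  (2021) 1479–1489 = arXiv:1811.09649, §2.1 Thm. 3 and §3 Lemma 1 (held text
  `paper:arxiv-1811.09649`, p. 5 and p. 7) [Fawzi2021].
* A. Bonami, Ann. Inst. Fourier 20 (1970) 335–402; W. Beckner, Ann. of Math. 102 (1975) 159–182
  (original sources).
-/

noncomputable section

namespace Literature.Computability.Complexity.LowDegree

open Finset Real Literature.Probability.RandomGraphs.LowDegree

variable {m : ℕ}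

/-! ### Positivity and mean preservation of the noise operator -/

/-- For `0 ≤ ρ ≤ 1` the noise kernel `∏ᵢ (1 + ρ χᵢ(x) χᵢ(y))` is nonnegative, so `T_ρ` maps
nonnegative functions to nonnegative functions. [cite: ODonnell2014, §2.4 (Def. 2.46: `T_ρ f(x) = E[f(y)]` over a `ρ`-correlated `y`)] -/
theorem noiseOperator_nonneg {ρ : ℝ} (hρ0 : 0 ≤ ρ) (hρ1 : ρ ≤ 1) {g : (Fin m → Bool) → ℝ}
    (hg : ∀ x, 0 ≤ g x) (y : Fin m → Bool) : 0 ≤ noiseOperator ρ g y := by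
  unfold noiseOperator
  refine div_nonneg (sum_nonneg fun x _ => mul_nonneg (hg x) (prod_nonneg fun i _ => ?_)) (by positivity)
  have h1 : -1 ≤ sgn (x i) * sgn (y i) := by
    cases x i <;> cases y i <;> simp [sgn]
  have h2 : sgn (x i) * sgn (y i) ≤ 1 := by
    cases x i <;> cases y i <;> simp [sgn]
  nlinarith

/-- `T_ρ` preserves the mean: `∑_y T_ρ g(y) = ∑_x g(x)` (self-adjointness against the constant `1`
and `T_ρ 1 = 1`). [cite: ODonnell2014, §2.4 (Prop. 2.47: `(T_ρ f)^(∅) = f̂(∅)`)] -/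
theorem sum_noiseOperator (ρ : ℝ) (g : (Fin m → Bool) → ℝ) :
    ∑ y, noiseOperator ρ g y = ∑ x, g x := by
  have h := sum_mul_noiseOperator_comm ρ g (fun _ => (1 : ℝ))
  rw [noiseOperator_const] at h
  simpa using h

/-! ### `(p, q)`-hypercontractivity for `p ≤ 2 ≤ q` -/

/-- **Hypercontractivity theorem on the uniform cube, range `1 < p ≤ 2 ≤ q`** (Bonami–Beckner;
O'Donnell 2014, Ch. 9; Fawzi 2021, Thm. 3): if `0 ≤ ρ` and `ρ² ≤ (p-1)/(q-1)` then
`(E|T_ρ g|^q)^{1/q} ≤ (E|g|^p)^{1/p}`.  Proof: `T_ρ = T_{ρ₂} T_{ρ₁}` with `ρ₁ = √(p-1)`,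
`ρ₂ = ρ/ρ₁`, `ρ₂² ≤ 1/(q-1)`; then `(2,q)`-hypercontractivity for `T_{ρ₂}` and `(p,2)` for `T_{ρ₁}`.
[cite: ODonnell2014, Ch. 9 (Hypercontractivity Theorem)] [cite: Fawzi2021, Thm. 3 (§2.1, p. 5)] -/
theorem noiseOperator_hypercontractive {p q ρ : ℝ} (hp : 1 < p) (hp2 : p ≤ 2) (hq : 2 ≤ q)
    (hρ0 : 0 ≤ ρ) (hρ : ρ ^ 2 ≤ (p - 1) / (q - 1)) (g : (Fin m → Bool) → ℝ) :
    ((∑ y, |noiseOperator ρ g y| ^ q) / 2 ^ m) ^ (1 / q) ≤ ((∑ x, |g x| ^ p) / 2 ^ m) ^ (1 / p) := by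
  have hp1 : 0 < p - 1 := by linarith
  have hq1 : 0 < q - 1 := by linarith
  set ρ₁ : ℝ := Real.sqrt (p - 1) with hρ₁
  have hρ₁pos : 0 < ρ₁ := Real.sqrt_pos.2 hp1
  have hρ₁sq : ρ₁ ^ 2 = p - 1 := Real.sq_sqrt hp1.le
  have hρ₁le : ρ₁ ≤ 1 := by
    rw [hρ₁, Real.sqrt_le_one]
    linarith
  set ρ₂ : ℝ := ρ / ρ₁ with hρ₂
  have hρ₂0 : 0 ≤ ρ₂ := div_nonneg hρ0 hρ₁pos.le
  have hρ₂sq : ρ₂ ^ 2 ≤ 1 / (q - 1) := by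
    rw [hρ₂, div_pow, hρ₁sq, div_le_iff₀ hp1]
    calc ρ ^ 2 ≤ (p - 1) / (q - 1) := hρ
      _ = 1 / (q - 1) * (p - 1) := by ring
  have hsemi : noiseOperator ρ g = noiseOperator ρ₂ (noiseOperator ρ₁ g) := by
    rw [noiseOperator_noiseOperator, hρ₂, div_mul_cancel₀ _ hρ₁pos.ne']
  rw [hsemi]
  refine (noiseOperator_hypercontractive_two_q hq hρ₂0 hρ₂sq _).trans ?_
  -- `(p,2)` for `T_{ρ₁}`: `E[(T_{ρ₁} g)²] ≤ (E|g|^p)^{2/p}`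
  have h2 := avg_sq_noiseOperator_le hρ₁pos hρ₁le g
  rw [hρ₁sq, show (1 : ℝ) + (p - 1) = p by ring] at h2
  have hG : 0 ≤ (∑ x, |g x| ^ p) / 2 ^ m := by positivity
  calc ((∑ y, noiseOperator ρ₁ g y ^ 2) / 2 ^ m) ^ (1 / 2 : ℝ)
      ≤ (((∑ x, |g x| ^ p) / 2 ^ m) ^ (2 / p)) ^ (1 / 2 : ℝ) :=
        Real.rpow_le_rpow (by positivity) h2 (by norm_num)
    _ = ((∑ x, |g x| ^ p) / 2 ^ m) ^ (1 / p) := by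
        rw [← Real.rpow_mul hG]
        congr 1
        field_simp

/-- The same inequality with both sides raised to the power `q`:
`E|T_ρ g|^q ≤ (E|g|^p)^{q/p}`. [cite: ODonnell2014, Ch. 9 (Hypercontractivity Theorem)] -/
theorem avg_rpow_noiseOperator_le {p q ρ : ℝ} (hp : 1 < p) (hp2 : p ≤ 2) (hq : 2 ≤ q)
    (hρ0 : 0 ≤ ρ) (hρ : ρ ^ 2 ≤ (p - 1) / (q - 1)) (g : (Fin m → Bool) → ℝ) :
    (∑ y, |noiseOperator ρ g y| ^ q) / 2 ^ m ≤ (((∑ x, |g x| ^ p) / 2 ^ m) ^ (1 / p)) ^ q := by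
  have hq0 : 0 < q := by linarith
  have h := noiseOperator_hypercontractive hp hp2 hq hρ0 hρ g
  have hA : 0 ≤ (∑ y, |noiseOperator ρ g y| ^ q) / 2 ^ m := by positivity
  calc (∑ y, |noiseOperator ρ g y| ^ q) / 2 ^ m
      = (((∑ y, |noiseOperator ρ g y| ^ q) / 2 ^ m) ^ (1 / q)) ^ q := by
        rw [← Real.rpow_mul hA, one_div_mul_cancel hq0.ne', Real.rpow_one]
    _ ≤ (((∑ x, |g x| ^ p) / 2 ^ m) ^ (1 / p)) ^ q :=
        Real.rpow_le_rpow (by positivity) h hq0.le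

/-! ### Fawzi's concentration lemma for `T_ρ f`, `f` a flat density -/

/-- **The `p`-th moment of a flat density**: if `0 ≤ f ≤ M` pointwise and `1 ≤ p` then
`E f^p ≤ M^{p-1} E f` ("`‖f‖_p = (E[f^p])^{1/p} ≤ (M^{p-1} E[f])^{1/p}`").
[cite: Fawzi2021, Lemma 1, proof (p. 7)] -/
theorem avg_rpow_le_pow_mul_avg {M p : ℝ} (hp : 1 ≤ p) {f : (Fin m → Bool) → ℝ}
    (hf0 : ∀ x, 0 ≤ f x) (hfM : ∀ x, f x ≤ M) :
    (∑ x, |f x| ^ p) / 2 ^ m ≤ M ^ (p - 1) * ((∑ x, f x) / 2 ^ m) := by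
  rw [mul_div_assoc', mul_sum]
  refine div_le_div_of_nonneg_right (sum_le_sum fun x _ => ?_) (by positivity)
  rw [abs_of_nonneg (hf0 x)]
  rcases (hf0 x).eq_or_lt with h0 | hpos
  · rw [← h0, Real.zero_rpow (by linarith)]
    simp
  · calc f x ^ p = f x ^ (p - 1) * f x := by
          rw [Real.rpow_sub_one hpos.ne', div_mul_cancel₀ _ hpos.ne']
      _ ≤ M ^ (p - 1) * f x :=
          mul_le_mul_of_nonneg_right (Real.rpow_le_rpow (hf0 x) (hfM x) (by linarith)) (hf0 x)

/-- **Fawzi 2021, Lemma 1 (tail of the noisy version of a flat density), counting form with symbolic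
parameters.**  "Assume `f : H_n → ℝ` with `f ≥ 0` such that `E[f] = 1` and `max f ≤ e^{√n}`. Assume
`ρ = √(5/n)`. Then `μ{x ∈ H_n : (T_ρ f)(x) ≥ 4} ≤ exp(-c√n)` for some absolute constant `c > 0`."
Here, following the printed proof line by line: for `f ≥ 0`, `E f = 1`, `max f ≤ M` with `log M ≥ 1`,
`p = 1 + 1/log M` and `q = 1 + (p-1)/ρ²` with `q ≥ 2`, and any `t > 0`,
`#{y : T_ρ f(y) ≥ t} ≤ 2^m (e/t)^q` — Markov's inequality on `|T_ρ f|^q`, the hypercontractive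
inequality `E|T_ρ f|^q ≤ ‖f‖_p^q`, and `‖f‖_p^p ≤ M^{p-1} E f = e` ("`M^{p-1} = exp(1)`").  With
`M = e^{√n}`, `ρ² = 5/n` one gets `q = 1 + √n/5` and the printed bound `(e/t)^{1 + n/(5 log M)}`.
[cite: Fawzi2021, Lemma 1 (§3, p. 7)] -/
theorem card_noiseOperator_ge_le {M ρ t : ℝ} (hM : 1 ≤ Real.log M) (hρ : 0 < ρ)
    (hq : 2 ≤ 1 + (1 / Real.log M) / ρ ^ 2) (ht : 0 < t)
    {f : (Fin m → Bool) → ℝ} (hf0 : ∀ x, 0 ≤ f x) (hfM : ∀ x, f x ≤ M)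
    (hmean : (∑ x, f x) / 2 ^ m = 1) :
    ((univ.filter fun y => t ≤ noiseOperator ρ f y).card : ℝ) ≤
      2 ^ m * (Real.exp 1 / t) ^ (1 + (1 / Real.log M) / ρ ^ 2) := by
  set L : ℝ := Real.log M with hL
  have hL0 : 0 < L := by linarith
  set p : ℝ := 1 + 1 / L with hp
  set q : ℝ := 1 + (1 / L) / ρ ^ 2 with hqdef
  have hp1 : 1 < p := by rw [hp]; have := one_div_pos.2 hL0; linarith
  have hp2 : p ≤ 2 := by
    rw [hp]
    have : 1 / L ≤ 1 := by rw [div_le_one hL0]; exact hM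
    linarith
  have hq0 : 0 < q := by linarith
  have hq1 : 0 < q - 1 := by linarith
  have h2m : (0 : ℝ) < 2 ^ m := by positivity
  -- the hypercontractive parameters: `ρ² = (p-1)/(q-1)` exactly
  have hρpq : ρ ^ 2 ≤ (p - 1) / (q - 1) := by
    have e : (p - 1) / (q - 1) = ρ ^ 2 := by
      rw [hp, hqdef, add_sub_cancel_left, add_sub_cancel_left]
      field_simp
    rw [e]
  -- (1) Markov on `|T_ρ f|^q`: `card · t^q ≤ ∑_y |T_ρ f y|^q`
  set S := univ.filter fun y => t ≤ noiseOperator ρ f y with hS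
  have hmarkov : (S.card : ℝ) * t ^ q ≤ ∑ y, |noiseOperator ρ f y| ^ q := by
    calc (S.card : ℝ) * t ^ q = ∑ y ∈ S, t ^ q := by rw [sum_const, nsmul_eq_mul]
      _ ≤ ∑ y ∈ S, |noiseOperator ρ f y| ^ q := sum_le_sum fun y hy => by
          rw [hS, mem_filter] at hy
          exact Real.rpow_le_rpow ht.le (hy.2.trans (le_abs_self _)) hq0.le
      _ ≤ ∑ y, |noiseOperator ρ f y| ^ q :=
          sum_le_sum_of_subset_of_nonneg (filter_subset _ _) fun y _ _ => by positivity
  -- (2) hypercontractivity: `E|T_ρ f|^q ≤ ‖f‖_p^q`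
  have hhc := avg_rpow_noiseOperator_le hp1 hp2 hq hρ.le hρpq f
  -- (3) `‖f‖_p^p ≤ M^{p-1} E f = M^{1/log M} = e`
  have hMpos : 0 < M := by
    -- `E f = 1 > 0`, so some `f x > 0`, and `f x ≤ M`
    by_contra h
    push Not at h
    have hz : ∀ x, f x = 0 := fun x => le_antisymm ((hfM x).trans h) (hf0 x)
    have : (∑ x, f x) / 2 ^ m = 0 := by simp [hz]
    rw [hmean] at this
    exact one_ne_zero this
  have hflat := avg_rpow_le_pow_mul_avg hp1.le hf0 hfM
  rw [hmean, mul_one] at hflat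
  have hMp : M ^ (p - 1) = Real.exp 1 := by
    rw [hp, add_sub_cancel_left, Real.rpow_def_of_pos hMpos, ← hL, mul_one_div, div_self hL0.ne']
  rw [hMp] at hflat
  -- so `‖f‖_p ≤ e^{1/p} ≤ e` and `‖f‖_p^q ≤ e^q`
  have hnorm : ((∑ x, |f x| ^ p) / 2 ^ m) ^ (1 / p) ≤ Real.exp 1 := by
    have h1 : ((∑ x, |f x| ^ p) / 2 ^ m) ^ (1 / p) ≤ Real.exp 1 ^ (1 / p) :=
      Real.rpow_le_rpow (by positivity) hflat (by positivity)
    refine h1.trans ?_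
    calc Real.exp 1 ^ (1 / p) ≤ Real.exp 1 ^ (1 : ℝ) :=
          Real.rpow_le_rpow_of_exponent_le (Real.one_le_exp zero_le_one)
            (by rw [div_le_one (by linarith)]; exact hp1.le)
      _ = Real.exp 1 := Real.rpow_one _
  have hnormq : (((∑ x, |f x| ^ p) / 2 ^ m) ^ (1 / p)) ^ q ≤ Real.exp 1 ^ q :=
    Real.rpow_le_rpow (by positivity) hnorm hq0.le
  -- assemble
  have htq : 0 < t ^ q := Real.rpow_pos_of_pos ht q
  have hmain : (S.card : ℝ) * t ^ q ≤ 2 ^ m * Real.exp 1 ^ q := by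
    have h1 : (∑ y, |noiseOperator ρ f y| ^ q) ≤ 2 ^ m * (((∑ x, |f x| ^ p) / 2 ^ m) ^ (1 / p)) ^ q := by
      rw [← div_le_iff₀' h2m]; exact hhc
    calc (S.card : ℝ) * t ^ q ≤ ∑ y, |noiseOperator ρ f y| ^ q := hmarkov
      _ ≤ 2 ^ m * (((∑ x, |f x| ^ p) / 2 ^ m) ^ (1 / p)) ^ q := h1
      _ ≤ 2 ^ m * Real.exp 1 ^ q := mul_le_mul_of_nonneg_left hnormq h2m.le
  rw [Real.div_rpow (Real.exp_pos 1).le ht.le, mul_div_assoc', le_div_iff₀ htq]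
  exact hmain

end Literature.Computability.Complexity.LowDegree

end
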